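import Summits.QuantumFields.BalabanUV.Beta.GAN24.CombExitFaceCurrentCellTotals
import Summits.QuantumFields.BalabanUV.Beta.GAN24.ExitFaceSlotStaircase

/-!
# `BalabanUV.Beta.GAN24.CombExitFaceSlotStaircase` — binder row G-an2-4 ∕ (CONV-C), W-slot CT-W, the COMB chart (III′), J2_comb step T1: **BOTH TWO-FACE CURRENTS OF THE TRANSPORTED COMB
# CUBIC SECTOR `V^c_j = e3OfK Lc G_j (𝒯S̃comb_j)` ARE `E2_{j+1}`-IMAGES OF «STAIRCASE × EXIT FACE»** — leaf-06 g53's `ExitFaceSlotStaircase` §1–§3 with the member replaced (the Ward pins,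
# every `d`, every `j`, every `cΛt cΛ`, kernel root spelled `toSite (ctrOff (d+1) Lc)` as in OWNER gan24-p1 g53's `hR`)

NOT IN PRINT; OUR BOOKKEEPING ([folklore] BY NAME: my R `CombExitFaceCurrentCellTotals.tsum_grad_mul_e3OfK_transport_ScombOf_inl_inl` (the comb L1′), leaf-06's member-free
`ValueHessianLinearGauge.tsum_E2_mul_exitFace_eq_zero′ ∕ tsum_exitFace_mul_E2_eq_zero′`, `ExitFaceHalfVertexSplit.summable_E2_mul_linGrowth_face ∕ summable_linGrowth_face_mul_E2`,
`ExitFaceSlotStaircase.coord_grad ∕ abs_coord_le ∕ stair_grad ∕ abs_stair_le`; G-an2-4 formalisation swarm, leaf prover `b2b-balaban-gan24-formalise-leaf-01`, gen 87, file T1).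
HONEST FRAMING (cell contract, verbatim): «discharging `BetaPertH` makes Bałaban's UV stability UNCONDITIONAL — a real constructive-QFT result; it is NOT the continuum limit and NOT the
Clay problem.»  HONEST DEPENDENCY (verbatim): «continuum YM on T⁴ ⇐ BetaPertH ∧ nine spine estimates (0/9 proved); BetaPertH ⇐ (D1) ∧ (D4) ∧ CAP+tail; G-an2-4 gates asym, D1 and NE2/3/4.»

WHAT ([folklore]; `[NeZero Lc]`, the Ward pins, every `d j cΛt cΛ`; 0 `def`, 0 cited facts, 0 `def … : Prop`, 0 sorry): §0 `tsum_grad_mul_e3OfK_transport_ScombOf_inl_inl'` (R's L1′ with the root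
spelled `toSite (ctrOff (d+1) Lc)`, `rfl`); §1 `slotSum_e3OfK_eq_coord` (`Σ'_t V^c_j ν t (x,z)_{ab} = ½·E2_{j+1}(x,z)_{ab}·(z_ν − x_ν)`); §2 `faceSlot_e3OfK_eq_stair` (`Σ'_t χ_ν(t)·V^c_j ν t (x,z)_{ab}
= ½·E2_{j+1}(x,z)_{ab}·(⌊z_ν∕Lc⌋ − ⌊x_ν∕Lc⌋)`); §3 **`faceface_e3OfK_eq_stair`** ∕ **`faceface_e3OfK_eq_stair_fst`** (the right ∕ left two-face currents in closed form).  Same names as leaf-06's,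
in the namespace `CombExitFaceSlotStaircase`.  Asserts NO value of Bałaban's tables; NEVER «G-an2-4 closed» as (CONV-C); NOT D1, NOT `BetaPertH`, NOT continuum, NOT Clay.  2026-08-27; no
existing file touched.
-/

noncomputable section

open Finset
open scoped BigOperators
open Literature.MathematicalPhysics.QuantumFieldTheory
open Literature.MathematicalPhysics.QuantumFieldTheory.Balaban1983to89
open Literature.MathematicalPhysics.QuantumFieldTheory.Balaban1983to89.Beta
open B12Sec2to5 (l1)
open ExpKernelCalculus (Site MKer comp)
open AffineAveraging (box toSite unitVec)
open AveragingContoursRooted (ctr ctrOff)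
open OneStepResolventKernel (Fib LocStencil)
open OneStepKernelFamily (KInvStep)
open BalabanStepJetsSucc (E2)
open Summit.QuantumFields.BalabanUV.Beta.TameKernelCalculus (trK)
open Summit.QuantumFields.BalabanUV.Beta.AxialDressingRooted (coDressKBmAt one_le_of_neZero)
open Summit.QuantumFields.BalabanUV.Beta.SpineRooted (e3OfK)
open Summit.QuantumFields.BalabanUV.Beta.SymSecondOrderTablesAn1 (symTablesAn1S2)
open Summit.QuantumFields.BalabanUV.Beta.CombChartStepJets (ScombOf)
open Summit.QuantumFields.BalabanUV.Beta.SymCorrectorKernel (psiKS)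
open Summit.QuantumFields.BalabanUV.Beta.SymCorrectorFace (slotPsiS)
open Summit.QuantumFields.BalabanUV.Beta.GAN24.ValueHessianLinearGauge (tsum_E2_mul_exitFace_eq_zero' tsum_exitFace_mul_E2_eq_zero')
open Summit.QuantumFields.BalabanUV.Beta.GAN24.ExitFaceHalfVertexSplit (summable_E2_mul_linGrowth_face summable_linGrowth_face_mul_E2)
open Summit.QuantumFields.BalabanUV.Beta.GAN24.ExitFaceSlotStaircase (coord_grad abs_coord_le stair_grad abs_stair_le)
open Summit.QuantumFields.BalabanUV.Beta.GAN24.CombExitFaceCurrentCellTotals (tsum_grad_mul_e3OfK_transport_ScombOf_inl_inl)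

namespace Summit.QuantumFields.BalabanUV.Beta.GAN24.CombExitFaceSlotStaircase

variable {d : ℕ} {Lc : ℕ} [NeZero Lc]

/-! ## §0 R's L1′ with the root spelled `toSite (ctrOff (d+1) Lc)` -/

/-- [folklore] **THE COMB CUBIC GAUGE LETTER FOR GAUGE FUNCTIONS OF LINEAR GROWTH**, kernel root spelled `toSite (ctrOff (d+1) Lc)` (`= ctr (d+1) Lc`, `rfl`). -/
theorem tsum_grad_mul_e3OfK_transport_ScombOf_inl_inl' (cΛt cΛ : ℝ) (j : ℕ) {g : Site (d + 1) → ℝ} {A B : ℝ} (hg : ∀ t, |g t| ≤ A + B * l1 t)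
    (x z : Site (d + 1)) (a b : Fin (d + 1)) :
    ∑' t, ∑ κ, (g (t + unitVec κ) - g t) * e3OfK Lc (coDressKBmAt (toSite (ctrOff (d + 1) Lc)) Lc (KInvStep (d := d) Lc j))
          (fun κ u => comp (comp (trK (psiKS (ctrOff (d + 1) Lc) Lc)) (slotPsiS (ctrOff (d + 1) Lc) Lc (ScombOf (symTablesAn1S2 d Lc cΛt) ((Lc : ℝ) ^ (d + 1)) (-((Lc : ℝ) ^ (d + 1) * (1 / 2) * (Lc : ℝ) ^ (d + 1))) cΛ j) κ u)) (psiKS (ctrOff (d + 1) Lc) Lc)) κ t x z (Sum.inl a) (Sum.inl b) =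
      (1 / 2 : ℝ) * E2 d Lc (j + 1) x z (Sum.inl a) (Sum.inl b) * (g z - g x) := by
  have h := tsum_grad_mul_e3OfK_transport_ScombOf_inl_inl (d := d) (Lc := Lc) cΛt cΛ j hg x z a b
  rw [show (ctr (d + 1) Lc : Site (d + 1)) = toSite (ctrOff (d + 1) Lc) from rfl] at h
  exact h

/-! ## §1 The full slot sum: the commutator of the value Hessian with the coordinate -/

/-- [folklore] **THE FULL SLOT SUM OF THE VALUE THIRD JET, IN CLOSED FORM** (every `j`, in-block root `toSite r`, pins `(cE, cVH) = (Lc^{d+1}, −Lc^{d+1}·½·Lc^{d+1})`, any `cΛ`):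
`Σ'_t V_j ν t (x,z)_{inl a, inl b} = ½·E2 d Lc (j+1) (x,z)_{ab}·(z_ν − x_ν)` — L1′ with the coordinate `g(t) = t_ν` (its gradient is the unit constant slot in direction `ν`). -/
theorem slotSum_e3OfK_eq_coord (cΛt cΛ : ℝ) (j : ℕ) (ν : Fin (d + 1)) (x z : Fin (d + 1) → ℤ) (a b : Fin (d + 1)) :
    ∑' t : Fin (d + 1) → ℤ, e3OfK Lc (coDressKBmAt (toSite (ctrOff (d + 1) Lc)) Lc (KInvStep (d := d) Lc j))
        (fun κ u => comp (comp (trK (psiKS (ctrOff (d + 1) Lc) Lc)) (slotPsiS (ctrOff (d + 1) Lc) Lc (ScombOf (symTablesAn1S2 d Lc cΛt) ((Lc : ℝ) ^ (d + 1)) (-((Lc : ℝ) ^ (d + 1) * (1 / 2) * (Lc : ℝ) ^ (d + 1))) cΛ j) κ u)) (psiKS (ctrOff (d + 1) Lc) Lc)) ν t x z (Sum.inl a) (Sum.inl b) =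
      (1 / 2 : ℝ) * E2 d Lc (j + 1) x z (Sum.inl a) (Sum.inl b) * (((z ν : ℤ) : ℝ) - ((x ν : ℤ) : ℝ)) := by
  have key := tsum_grad_mul_e3OfK_transport_ScombOf_inl_inl' (d := d) (Lc := Lc) cΛt cΛ j (g := fun t : Fin (d + 1) → ℤ => ((t ν : ℤ) : ℝ)) (abs_coord_le ν) x z a b
  rw [← key]
  refine tsum_congr fun t => ?_
  rw [Finset.sum_eq_single ν (fun κ _ hκ => by rw [coord_grad ν κ t, if_neg hκ, zero_mul]) (fun h => absurd (Finset.mem_univ ν) h),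
    coord_grad ν ν t, if_pos rfl, one_mul]

/-! ## §2 The face-gated slot sum: the commutator of the value Hessian with the staircase -/

/-- [folklore] **THE EXIT-FACE-GATED SLOT SUM OF THE VALUE THIRD JET, IN CLOSED FORM** (every `j`, in-block root, pins as above, any `cΛ`):
`Σ'_t χ_ν(t)·V_j ν t (x,z)_{inl a, inl b} = ½·E2 d Lc (j+1) (x,z)_{ab}·(⌊z_ν∕Lc⌋ − ⌊x_ν∕Lc⌋)` — L1′ with the staircase `g(t) = ⌊t_ν∕Lc⌋` (its gradient is the exit-face slot). -/
theorem faceSlot_e3OfK_eq_stair (cΛt cΛ : ℝ) (j : ℕ) (ν : Fin (d + 1)) (x z : Fin (d + 1) → ℤ) (a b : Fin (d + 1)) :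
    (∑' t : Fin (d + 1) → ℤ, (if t ν % (Lc : ℤ) = (Lc : ℤ) - 1 then
        e3OfK Lc (coDressKBmAt (toSite (ctrOff (d + 1) Lc)) Lc (KInvStep (d := d) Lc j))
          (fun κ u => comp (comp (trK (psiKS (ctrOff (d + 1) Lc) Lc)) (slotPsiS (ctrOff (d + 1) Lc) Lc (ScombOf (symTablesAn1S2 d Lc cΛt) ((Lc : ℝ) ^ (d + 1)) (-((Lc : ℝ) ^ (d + 1) * (1 / 2) * (Lc : ℝ) ^ (d + 1))) cΛ j) κ u)) (psiKS (ctrOff (d + 1) Lc) Lc)) ν t x z (Sum.inl a) (Sum.inl b) else 0)) =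
      (1 / 2 : ℝ) * E2 d Lc (j + 1) x z (Sum.inl a) (Sum.inl b) * ((((z ν / (Lc : ℤ) : ℤ) : ℝ)) - (((x ν / (Lc : ℤ) : ℤ) : ℝ))) := by
  have hLc : 1 ≤ Lc := one_le_of_neZero Lc
  have key := tsum_grad_mul_e3OfK_transport_ScombOf_inl_inl' (d := d) (Lc := Lc) cΛt cΛ j (g := fun t : Fin (d + 1) → ℤ => (((t ν / (Lc : ℤ) : ℤ) : ℝ))) (abs_stair_le ν) x z a b
  rw [← key]
  refine tsum_congr fun t => ?_
  rw [Finset.sum_eq_single ν (fun κ _ hκ => by rw [stair_grad hLc ν κ t, if_neg hκ, zero_mul]) (fun h => absurd (Finset.mem_univ ν) h),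
    stair_grad hLc ν ν t, if_pos rfl]
  split_ifs
  · rw [one_mul]
  · rw [zero_mul]

/-! ## §3 The two-face currents of the E-sector EE word are value-Hessian images of «staircase × exit face» -/

/-- [folklore] **THE RIGHT TWO-FACE CURRENT IN CLOSED FORM** (open first leg `(b, z)`, exit-face weight `χ_β` on the second leg, face-gated slot in direction `ν`):
`Σ'_{s′} χ_β(s′)·Σ'_t χ_ν(t)·V_j ν t (z,s′)_{inl b, inl β} = ½·Σ'_{s′} E2 d Lc (j+1) (z,s′)_{bβ}·(⌊s′_ν∕Lc⌋·χ_β(s′))` — §2 pointwise in `s′`; the `⌊z_ν∕Lc⌋`-half is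
`⌊z_ν∕Lc⌋·Σ'_{s′} E2(z,s′)_{bβ}·χ_β(s′) = 0` (D1: the value Hessian kills the exit-face profile). -/
theorem faceface_e3OfK_eq_stair (cΛt cΛ : ℝ) (j : ℕ) (ν β : Fin (d + 1)) (z : Fin (d + 1) → ℤ) (b : Fin (d + 1)) :
    (∑' s' : Fin (d + 1) → ℤ, (if s' β % (Lc : ℤ) = (Lc : ℤ) - 1 then (1 : ℝ) else 0) *
        ∑' t : Fin (d + 1) → ℤ, (if t ν % (Lc : ℤ) = (Lc : ℤ) - 1 then
          e3OfK Lc (coDressKBmAt (toSite (ctrOff (d + 1) Lc)) Lc (KInvStep (d := d) Lc j))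
            (fun κ u => comp (comp (trK (psiKS (ctrOff (d + 1) Lc) Lc)) (slotPsiS (ctrOff (d + 1) Lc) Lc (ScombOf (symTablesAn1S2 d Lc cΛt) ((Lc : ℝ) ^ (d + 1)) (-((Lc : ℝ) ^ (d + 1) * (1 / 2) * (Lc : ℝ) ^ (d + 1))) cΛ j) κ u)) (psiKS (ctrOff (d + 1) Lc) Lc)) ν t z s' (Sum.inl b) (Sum.inl β) else 0)) =
      (1 / 2 : ℝ) * ∑' s' : Fin (d + 1) → ℤ, E2 d Lc (j + 1) z s' (Sum.inl b) (Sum.inl β) *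
        ((((s' ν / (Lc : ℤ) : ℤ) : ℝ)) * (if s' β % (Lc : ℤ) = (Lc : ℤ) - 1 then (1 : ℝ) else 0)) := by
  have hLc : 1 ≤ Lc := one_le_of_neZero Lc
  have hpt : ∀ s' : Fin (d + 1) → ℤ, (if s' β % (Lc : ℤ) = (Lc : ℤ) - 1 then (1 : ℝ) else 0) *
      (∑' t : Fin (d + 1) → ℤ, (if t ν % (Lc : ℤ) = (Lc : ℤ) - 1 then
        e3OfK Lc (coDressKBmAt (toSite (ctrOff (d + 1) Lc)) Lc (KInvStep (d := d) Lc j))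
          (fun κ u => comp (comp (trK (psiKS (ctrOff (d + 1) Lc) Lc)) (slotPsiS (ctrOff (d + 1) Lc) Lc (ScombOf (symTablesAn1S2 d Lc cΛt) ((Lc : ℝ) ^ (d + 1)) (-((Lc : ℝ) ^ (d + 1) * (1 / 2) * (Lc : ℝ) ^ (d + 1))) cΛ j) κ u)) (psiKS (ctrOff (d + 1) Lc) Lc)) ν t z s' (Sum.inl b) (Sum.inl β) else 0)) =
      (1 / 2 : ℝ) * (E2 d Lc (j + 1) z s' (Sum.inl b) (Sum.inl β) * ((((s' ν / (Lc : ℤ) : ℤ) : ℝ)) * (if s' β % (Lc : ℤ) = (Lc : ℤ) - 1 then (1 : ℝ) else 0)))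
        - (1 / 2 : ℝ) * (E2 d Lc (j + 1) z s' (Sum.inl b) (Sum.inl β) * (if s' β % (Lc : ℤ) = (Lc : ℤ) - 1 then (((z ν / (Lc : ℤ) : ℤ) : ℝ)) else 0)) := by
    intro s'
    rw [faceSlot_e3OfK_eq_stair cΛt cΛ j ν z s' b β]
    split_ifs <;> ring
  have h1 := summable_E2_mul_linGrowth_face (d := d) (Lc := Lc) j (lam := fun s : Fin (d + 1) → ℤ => (((s ν / (Lc : ℤ) : ℤ) : ℝ))) (abs_stair_le ν) z b β
  have h2 : Summable fun s' : Fin (d + 1) → ℤ =>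
      E2 d Lc (j + 1) z s' (Sum.inl b) (Sum.inl β) * (if s' β % (Lc : ℤ) = (Lc : ℤ) - 1 then (((z ν / (Lc : ℤ) : ℤ) : ℝ)) else 0) := by
    have h := summable_E2_mul_linGrowth_face (d := d) (Lc := Lc) j (lam := fun _ : Fin (d + 1) → ℤ => (((z ν / (Lc : ℤ) : ℤ) : ℝ)))
      (A := |(((z ν / (Lc : ℤ) : ℤ) : ℝ))|) (B := 0) (fun _ => by rw [zero_mul, add_zero]) z b β
    refine h.congr fun s' => ?_
    split_ifs <;> simp
  rw [tsum_congr hpt, (h1.mul_left (1 / 2 : ℝ)).tsum_sub (h2.mul_left (1 / 2 : ℝ)), tsum_mul_left, tsum_mul_left,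
    tsum_E2_mul_exitFace_eq_zero' (Lc := Lc) (j + 1) hLc b β z ((((z ν / (Lc : ℤ) : ℤ) : ℝ))), mul_zero, sub_zero]

/-- [folklore] **THE LEFT TWO-FACE CURRENT IN CLOSED FORM** (exit-face weight `χ_α` on the first leg, open second leg `(a, x)`, face-gated slot in direction `μ`):
`Σ'_y χ_α(y)·Σ'_t χ_μ(t)·V_j μ t (y,x)_{inl α, inl a} = −½·Σ'_y (⌊y_μ∕Lc⌋·χ_α(y))·E2 d Lc (j+1) (y,x)_{αa}` — §2 at the legs `(y, x)`; the `⌊x_μ∕Lc⌋`-half dies by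
D1's row form. -/
theorem faceface_e3OfK_eq_stair_fst (cΛt cΛ : ℝ) (j : ℕ) (μ α : Fin (d + 1)) (x : Fin (d + 1) → ℤ) (a : Fin (d + 1)) :
    (∑' y : Fin (d + 1) → ℤ, (if y α % (Lc : ℤ) = (Lc : ℤ) - 1 then (1 : ℝ) else 0) *
        ∑' t : Fin (d + 1) → ℤ, (if t μ % (Lc : ℤ) = (Lc : ℤ) - 1 then
          e3OfK Lc (coDressKBmAt (toSite (ctrOff (d + 1) Lc)) Lc (KInvStep (d := d) Lc j))
            (fun κ u => comp (comp (trK (psiKS (ctrOff (d + 1) Lc) Lc)) (slotPsiS (ctrOff (d + 1) Lc) Lc (ScombOf (symTablesAn1S2 d Lc cΛt) ((Lc : ℝ) ^ (d + 1)) (-((Lc : ℝ) ^ (d + 1) * (1 / 2) * (Lc : ℝ) ^ (d + 1))) cΛ j) κ u)) (psiKS (ctrOff (d + 1) Lc) Lc)) μ t y x (Sum.inl α) (Sum.inl a) else 0)) =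
      -(1 / 2 : ℝ) * ∑' y : Fin (d + 1) → ℤ, ((((y μ / (Lc : ℤ) : ℤ) : ℝ)) * (if y α % (Lc : ℤ) = (Lc : ℤ) - 1 then (1 : ℝ) else 0)) *
        E2 d Lc (j + 1) y x (Sum.inl α) (Sum.inl a) := by
  have hLc : 1 ≤ Lc := one_le_of_neZero Lc
  have hpt : ∀ y : Fin (d + 1) → ℤ, (if y α % (Lc : ℤ) = (Lc : ℤ) - 1 then (1 : ℝ) else 0) *
      (∑' t : Fin (d + 1) → ℤ, (if t μ % (Lc : ℤ) = (Lc : ℤ) - 1 then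
        e3OfK Lc (coDressKBmAt (toSite (ctrOff (d + 1) Lc)) Lc (KInvStep (d := d) Lc j))
          (fun κ u => comp (comp (trK (psiKS (ctrOff (d + 1) Lc) Lc)) (slotPsiS (ctrOff (d + 1) Lc) Lc (ScombOf (symTablesAn1S2 d Lc cΛt) ((Lc : ℝ) ^ (d + 1)) (-((Lc : ℝ) ^ (d + 1) * (1 / 2) * (Lc : ℝ) ^ (d + 1))) cΛ j) κ u)) (psiKS (ctrOff (d + 1) Lc) Lc)) μ t y x (Sum.inl α) (Sum.inl a) else 0)) =
      (1 / 2 : ℝ) * ((if y α % (Lc : ℤ) = (Lc : ℤ) - 1 then (((x μ / (Lc : ℤ) : ℤ) : ℝ)) else 0) * E2 d Lc (j + 1) y x (Sum.inl α) (Sum.inl a))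
        - (1 / 2 : ℝ) * (((((y μ / (Lc : ℤ) : ℤ) : ℝ)) * (if y α % (Lc : ℤ) = (Lc : ℤ) - 1 then (1 : ℝ) else 0)) * E2 d Lc (j + 1) y x (Sum.inl α) (Sum.inl a)) := by
    intro y
    rw [faceSlot_e3OfK_eq_stair cΛt cΛ j μ y x α a]
    split_ifs <;> ring
  have h2 := summable_linGrowth_face_mul_E2 (d := d) (Lc := Lc) j (lam := fun y : Fin (d + 1) → ℤ => (((y μ / (Lc : ℤ) : ℤ) : ℝ))) (abs_stair_le μ) x α a
  have h1 : Summable fun y : Fin (d + 1) → ℤ =>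
      (if y α % (Lc : ℤ) = (Lc : ℤ) - 1 then (((x μ / (Lc : ℤ) : ℤ) : ℝ)) else 0) * E2 d Lc (j + 1) y x (Sum.inl α) (Sum.inl a) := by
    have h := summable_linGrowth_face_mul_E2 (d := d) (Lc := Lc) j (lam := fun _ : Fin (d + 1) → ℤ => (((x μ / (Lc : ℤ) : ℤ) : ℝ)))
      (A := |(((x μ / (Lc : ℤ) : ℤ) : ℝ))|) (B := 0) (fun _ => by rw [zero_mul, add_zero]) x α a
    refine h.congr fun y => ?_
    split_ifs <;> simp
  rw [tsum_congr hpt, (h1.mul_left (1 / 2 : ℝ)).tsum_sub (h2.mul_left (1 / 2 : ℝ)), tsum_mul_left, tsum_mul_left,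
    tsum_exitFace_mul_E2_eq_zero' (Lc := Lc) (j + 1) hLc a α x ((((x μ / (Lc : ℤ) : ℤ) : ℝ))), mul_zero, zero_sub, neg_mul]

end Summit.QuantumFields.BalabanUV.Beta.GAN24.CombExitFaceSlotStaircase

end
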